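import Mathlib

/-!
# Route `SymPencil` — inner rank of the `2 | 2` row split of `per_4`: linear families of maps of
# rank `≤ 1` (`--supports` stmt-ValiantsHypothesis-5674 `SdcSuperquadratic`; (8,8) column,
# isotropic-kernel route, step (B5)(RO) of memo `NOTE-p6g15-5674-IR12-reduction.md` §10)

**Theorem** (`rank_one_family`).  Let `M : A →ₗ X →ₗ (ι → K)` be a linear family of linear maps
all of rank `≤ 1` (all `2 × 2` minors `M a x r · M a x' r' - M a x' r · M a x r'` vanish — the
output format of `SymPencilPerFourInnerRankSlotA.slotA_rank_le_one`).  Then either all `M a` have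
their image in one common line `K v₀`, or there is a non-zero linear functional `φ` on `X` with
`M a x = 0` whenever `φ x = 0` (a common kernel hyperplane; then `M a x = φ(x) · v(a)`).

Classical three-element argument: two non-zero rank-one maps whose sum has rank `≤ 1` share the
image line or the kernel.  Use: applied to `a ↦ A₂(a)` etc. after the four slot theorems
(`…Slots`), it starts the rank kills / normal form of memo §3/§10.  Honest framing: linear
algebra in a conditional reduction of the cells `(8,8,10)`, `(8,8,11)`; nothing about the
window, the crux or `VP ≠ VNP`.  No definitions, no named facts. [folklore]
-/

noncomputable section

-- single-conjunct layout: Sub = Summit, duplicated namespace component intended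
set_option linter.dupNamespace false

namespace Summit.ValiantsHypothesis.ValiantsHypothesis.Theorems.SymPencilPerFourInnerRankRankOne

variable {K : Type*} [Field K] {ι : Type*} {A X : Type*} [AddCommGroup A] [Module K A]
  [AddCommGroup X] [Module K X]

/-- Rank `≤ 1` (vanishing `2 × 2` minors): every image vector is a multiple of a non-zero one.
[folklore] -/
theorem exists_smul_of_minors (N : X →ₗ[K] (ι → K))
    (hmin : ∀ (x x' : X) (r r' : ι), N x r * N x' r' = N x' r * N x r')
    (x : X) (r₀ : ι) (hx : N x r₀ ≠ 0) (x' : X) : ∃ s : K, N x' = s • N x := by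
  refine ⟨N x' r₀ / N x r₀, funext fun r => ?_⟩
  have h := hmin x x' r₀ r
  simp only [Pi.smul_apply, smul_eq_mul]
  field_simp
  linear_combination h

/-- **Linear families of rank `≤ 1` maps have a common image line or a common kernel
hyperplane.** See the module docstring. [folklore] -/
theorem rank_one_family (M : A →ₗ[K] X →ₗ[K] (ι → K))
    (hmin : ∀ (a : A) (x x' : X) (r r' : ι), M a x r * M a x' r' = M a x' r * M a x r') :
    (∃ v₀ : ι → K, ∀ a x, ∃ s : K, M a x = s • v₀) ∨
    (∃ φ : X →ₗ[K] K, φ ≠ 0 ∧ ∀ a x, φ x = 0 → M a x = 0) := by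
  classical
  by_cases hz : ∀ a x, M a x = 0
  · exact Or.inl ⟨0, fun a x => ⟨0, by rw [hz a x, smul_zero]⟩⟩
  push Not at hz
  obtain ⟨a₀, x₀, h00⟩ := hz
  obtain ⟨r₀, hr₀⟩ : ∃ r, M a₀ x₀ r ≠ 0 := by
    by_contra h
    push Not at h
    exact h00 (funext h)
  -- the candidate functional: `φ₀ x = (M a₀ x) r₀`, with kernel `ker (M a₀)`
  let φ₀ : X →ₗ[K] K := (LinearMap.proj r₀).comp (M a₀)
  have hφ₀ : ∀ x, φ₀ x = M a₀ x r₀ := fun x => rfl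
  have hK0 : ∀ x, φ₀ x = 0 → M a₀ x = 0 := by
    intro x hx
    obtain ⟨s, hs⟩ := exists_smul_of_minors (M a₀) (hmin a₀) x₀ r₀ hr₀ x
    have h1 : s * M a₀ x₀ r₀ = 0 := by
      have := congr_fun hs r₀
      rw [Pi.smul_apply, smul_eq_mul] at this
      rw [← this, ← hφ₀]; exact hx
    have hs0 : s = 0 := (mul_eq_zero.1 h1).resolve_right hr₀
    rw [hs, hs0, zero_smul]
  by_contra hcon
  push Not at hcon
  obtain ⟨h1, h2⟩ := hcon
  -- `a₁, x₁` with `M a₁ x₁ ∉ K u₀`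
  obtain ⟨a₁, x₁, hu₁⟩ := h1 (M a₀ x₀)
  -- `a₂, x₂` with `φ₀ x₂ = 0` (so `M a₀ x₂ = 0`) and `M a₂ x₂ ≠ 0`
  obtain ⟨a₂, x₂, hx₂, hu₂⟩ := h2 φ₀ (fun h => by
    have := hφ₀ x₀; rw [h, LinearMap.zero_apply] at this; exact hr₀ this.symm)
  have h02 : M a₀ x₂ = 0 := hK0 x₂ hx₂
  have hu₁ne : M a₁ x₁ ≠ 0 := fun h => hu₁ 0 (by rw [h, zero_smul])
  obtain ⟨r₁, hr₁⟩ : ∃ r, M a₁ x₁ r ≠ 0 := by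
    by_contra h; push Not at h; exact hu₁ne (funext h)
  obtain ⟨r₂, hr₂⟩ : ∃ r, M a₂ x₂ r ≠ 0 := by
    by_contra h; push Not at h; exact hu₂ (funext h)
  -- generic step: if `M b z = w ≠ 0` and `M b x = u + w'` with `w, w'` on a line `K q` (`q ≠ 0`),
  -- then `u ∈ K q`.
  have key : ∀ (b : A) (z x : X) (u q : ι → K) (rq : ι), q rq ≠ 0 →
      (∃ s : K, s ≠ 0 ∧ M b z = s • q) → (∃ s' : K, M b x = u + s' • q) → ∃ μ : K, u = μ • q := by
    rintro b z x u q rq hq ⟨s, hs, hz⟩ ⟨s', hx⟩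
    have hzr : M b z rq ≠ 0 := by
      rw [hz, Pi.smul_apply, smul_eq_mul]; exact mul_ne_zero hs hq
    obtain ⟨μ, hμ⟩ := exists_smul_of_minors (M b) (hmin b) z rq hzr x
    refine ⟨μ * s - s', ?_⟩
    have : u = M b x - s' • q := by rw [hx, add_sub_cancel_right]
    rw [this, hμ, hz, smul_smul, sub_smul]
  -- (1) `M a₁ x₂ = 0`
  have h12 : M a₁ x₂ = 0 := by
    by_contra hne
    -- `M a₁ x₂ = s • u₁` with `s ≠ 0`
    obtain ⟨s, hs⟩ := exists_smul_of_minors (M a₁) (hmin a₁) x₁ r₁ hr₁ x₂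
    have hs0 : s ≠ 0 := fun h => hne (by rw [hs, h, zero_smul])
    obtain ⟨s', hs'⟩ := exists_smul_of_minors (M a₁) (hmin a₁) x₁ r₁ hr₁ x₀
    -- `M (a₀ + a₁) x₂ = s • u₁`, `M (a₀ + a₁) x₀ = u₀ + s' • u₁`
    obtain ⟨μ, hμ⟩ := key (a₀ + a₁) x₂ x₀ (M a₀ x₀) (M a₁ x₁) r₁ hr₁
      ⟨s, hs0, by rw [map_add, LinearMap.add_apply, h02, zero_add, hs]⟩
      ⟨s', by rw [map_add, LinearMap.add_apply, hs']⟩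
    -- so `u₀ = μ • u₁`, `μ ≠ 0`, `u₁ = μ⁻¹ • u₀`
    have hμ0 : μ ≠ 0 := fun h => h00 (by rw [hμ, h, zero_smul])
    exact hu₁ μ⁻¹ (by rw [hμ, smul_smul, inv_mul_cancel₀ hμ0, one_smul])
  -- (2) `u₂ ∈ K u₀`
  obtain ⟨ν, hν⟩ : ∃ ν : K, M a₀ x₀ = ν • M a₂ x₂ := by
    obtain ⟨s'', hs''⟩ := exists_smul_of_minors (M a₂) (hmin a₂) x₂ r₂ hr₂ x₀
    exact key (a₀ + a₂) x₂ x₀ (M a₀ x₀) (M a₂ x₂) r₂ hr₂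
      ⟨1, one_ne_zero, by rw [map_add, LinearMap.add_apply, h02, zero_add, one_smul]⟩
      ⟨s'', by rw [map_add, LinearMap.add_apply, hs'']⟩
  have hν0 : ν ≠ 0 := fun h => h00 (by rw [hν, h, zero_smul])
  -- (3) pair `(a₁, a₂)`: `u₁ ∈ K u₂ = K u₀`, contradiction
  obtain ⟨κ, hκ⟩ : ∃ κ : K, M a₁ x₁ = κ • M a₂ x₂ := by
    obtain ⟨s''', hs'''⟩ := exists_smul_of_minors (M a₂) (hmin a₂) x₂ r₂ hr₂ x₁
    exact key (a₁ + a₂) x₂ x₁ (M a₁ x₁) (M a₂ x₂) r₂ hr₂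
      ⟨1, one_ne_zero, by rw [map_add, LinearMap.add_apply, h12, zero_add, one_smul]⟩
      ⟨s''', by rw [map_add, LinearMap.add_apply, hs''']⟩
  refine hu₁ (κ * ν⁻¹) ?_
  rw [hκ, hν, smul_smul, mul_assoc, inv_mul_cancel₀ hν0, mul_one]

end Summit.ValiantsHypothesis.ValiantsHypothesis.Theorems.SymPencilPerFourInnerRankRankOne

end
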